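import Mathlib
import Literature.Analysis.FluidPDE.GaussianVortexPlanar
import HarnessLib
import Summits.AnomalousDissipation.AnomalousDissipation.Theorems.MarginalStabilityChainStretchedVortexRowsStubLogPotentialTools
import Summits.AnomalousDissipation.AnomalousDissipation.Theorems.MarginalStabilityChainStretchedVortexRowsStubLogPotentialGradient
import Summits.AnomalousDissipation.AnomalousDissipation.Theorems.MarginalStabilityChainStretchedVortexRowsStubLogPotentialGainA

/-!
# `logPotential_gain` — registered helper stub toward `stub_cellStreamSolvability`
(crux stmt-AnomalousDissipation-3009 `MarginalStabilityChain.StretchedVortexRows`, line `braid-closed-large-circulation-gluing`)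

For a merely **bounded measurable** density `|g(η)| ≤ B e^{−‖η‖²/8}` on `ℝ² = EuclideanSpace ℝ (Fin 2)` the logarithmic
potential `ψ = N ∗ g`, `N = (2π)⁻¹ log ‖·‖`, is `C¹`, its gradient is the absolutely convergent Biot–Savart-type integral
`∇ψ(ξ) = ∫ g(η) DN(ξ − η) dη`, `DN(z) = (2π‖z‖²)⁻¹ z`, and `|ψ(ξ)| ≤ C (1 + log(1 + ‖ξ‖))`, `‖∇ψ(ξ)‖ ≤ C`.

The derivative is gained from the kernel (helper file `…StubLogPotentialGainA`: regularisation
`N_ε = (4π)⁻¹ log(‖·‖² + ε²)`, differentiation under the integral sign for `ψ_ε = N_ε ∗ g`, uniform convergence of the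
regularised gradients and `hasFDerivAt_of_tendstoUniformly`); here the `C¹` property (`contDiff_one_iff_fderiv`), the
gradient formula (Riesz identification `gradient = toDual.symm ∘ fderiv`, `ContinuousLinearMap.integral_apply`,
`integral_inner`) and the two bounds (`abs_logPotential_le`; `‖∇ψ‖ ≤ ∫ ‖g DN(ξ − ·)‖ ≤ M` uniformly, as the kernel is
`≤ (2π)⁻¹(𝟙_{‖z‖<1}‖z‖⁻¹ + 1)`) are assembled.
-/

set_option linter.dupNamespace false

noncomputable section

open scoped BigOperators Topology RealInnerProductSpace ContDiff Laplacian
open Filter Set Function MeasureTheory WithLp Metric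

namespace Summit.AnomalousDissipation.AnomalousDissipation.Theorems.MarginalStabilityChainStretchedVortexRows

open Literature.Analysis.FluidPDE

/-- The Biot–Savart-type integrand `g(η) DN(ξ − η)` of a bounded measurable Gaussian-class density is integrable. [folklore] -/
theorem gain_integrable_smul_gradLogKernel {B : ℝ} {g : EuclideanSpace ℝ (Fin 2) → ℝ} (hg : Measurable g)
    (hg0 : ∀ η, |g η| ≤ B * Real.exp (-(1 / 8) * ‖η‖ ^ 2)) (ξ : EuclideanSpace ℝ (Fin 2)) :
    Integrable fun η : EuclideanSpace ℝ (Fin 2) => g η • ((2 * Real.pi * ‖ξ - η‖ ^ 2)⁻¹ • (ξ - η)) := by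
  -- adapted from `integrable_smul_gradLogKernel` (continuity of `g` replaced by measurability)
  have hB : 0 ≤ B := (abs_nonneg _).trans ((hg0 0).trans (le_of_eq (by simp)))
  refine ((integrable_inv_norm_sub_mul_exp ξ).const_mul ((2 * Real.pi)⁻¹ * B)).mono' ?_
    (Eventually.of_forall fun η => ?_)
  · exact (hg.smul ((((measurable_const.mul ((measurable_norm.comp
      (measurable_const.sub measurable_id)).pow_const 2)).inv).smul
      (measurable_const.sub measurable_id)))).aestronglyMeasurable
  rw [norm_smul, norm_gradLogKernel, Real.norm_eq_abs]
  calc |g η| * ((2 * Real.pi)⁻¹ * ‖ξ - η‖⁻¹) ≤ B * Real.exp (-(1 / 8) * ‖η‖ ^ 2) * ((2 * Real.pi)⁻¹ * ‖ξ - η‖⁻¹) :=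
        mul_le_mul_of_nonneg_right (hg0 η) (by positivity)
    _ = _ := by ring

/-- Uniform bound for the absolutely convergent gradient integrals of a bounded measurable Gaussian-class density:
`∫ ‖g(η) DN(ξ − η)‖ dη ≤ M` for all `ξ` (`‖DN(z)‖ e^{−‖η‖²/8} ≤ (2π)⁻¹ (𝟙_{‖z‖<1} ‖z‖⁻¹ + e^{−‖η‖²/8})`). [folklore] -/
theorem gain_exists_integral_norm_le {B : ℝ} {g : EuclideanSpace ℝ (Fin 2) → ℝ} (hg : Measurable g)
    (hg0 : ∀ η, |g η| ≤ B * Real.exp (-(1 / 8) * ‖η‖ ^ 2)) :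
    ∃ M : ℝ, ∀ ξ : EuclideanSpace ℝ (Fin 2),
      ∫ η, ‖g η • ((2 * Real.pi * ‖ξ - η‖ ^ 2)⁻¹ • (ξ - η))‖ ≤ M := by
  -- adapted from `exists_integral_norm_smul_gradLogKernel_le` (continuity of `g` replaced by measurability)
  have hB : 0 ≤ B := (abs_nonneg _).trans ((hg0 0).trans (le_of_eq (by simp)))
  have hI := gain_integrable_exp
  refine ⟨(2 * Real.pi)⁻¹ * B *
    ((∫ z, (ball (0 : EuclideanSpace ℝ (Fin 2)) 1).indicator (fun z => ‖z‖⁻¹) z) +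
      ∫ η : EuclideanSpace ℝ (Fin 2), Real.exp (-(1 / 8) * ‖η‖ ^ 2)), fun ξ => ?_⟩
  have h1 : Integrable fun η : EuclideanSpace ℝ (Fin 2) =>
      (ball (0 : EuclideanSpace ℝ (Fin 2)) 1).indicator (fun z => ‖z‖⁻¹) (ξ - η) :=
    integrable_indicator_inv_norm.comp_sub_left ξ
  have hle : ∀ η, ‖g η • ((2 * Real.pi * ‖ξ - η‖ ^ 2)⁻¹ • (ξ - η))‖ ≤ (2 * Real.pi)⁻¹ * B *
      ((ball (0 : EuclideanSpace ℝ (Fin 2)) 1).indicator (fun z => ‖z‖⁻¹) (ξ - η) +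
        Real.exp (-(1 / 8) * ‖η‖ ^ 2)) := by
    intro η
    rw [norm_smul, norm_gradLogKernel, Real.norm_eq_abs]
    have he : Real.exp (-(1 / 8) * ‖η‖ ^ 2) ≤ 1 := Real.exp_le_one_iff.2 (by nlinarith [norm_nonneg η])
    have he0 : 0 ≤ Real.exp (-(1 / 8) * ‖η‖ ^ 2) := (Real.exp_pos _).le
    have hi0 : 0 ≤ ‖ξ - η‖⁻¹ := inv_nonneg.2 (norm_nonneg _)
    have key : ‖ξ - η‖⁻¹ * Real.exp (-(1 / 8) * ‖η‖ ^ 2) ≤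
        (ball (0 : EuclideanSpace ℝ (Fin 2)) 1).indicator (fun z => ‖z‖⁻¹) (ξ - η) +
          Real.exp (-(1 / 8) * ‖η‖ ^ 2) := by
      by_cases hb : ξ - η ∈ ball (0 : EuclideanSpace ℝ (Fin 2)) 1
      · rw [indicator_of_mem hb]; nlinarith
      · rw [indicator_of_notMem hb, zero_add]
        have h3 : ‖ξ - η‖⁻¹ ≤ 1 := inv_le_one_of_one_le₀ (by simpa [mem_ball_zero_iff] using hb)
        nlinarith
    calc |g η| * ((2 * Real.pi)⁻¹ * ‖ξ - η‖⁻¹)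
        ≤ B * Real.exp (-(1 / 8) * ‖η‖ ^ 2) * ((2 * Real.pi)⁻¹ * ‖ξ - η‖⁻¹) :=
          mul_le_mul_of_nonneg_right (hg0 η) (by positivity)
      _ = (2 * Real.pi)⁻¹ * B * (‖ξ - η‖⁻¹ * Real.exp (-(1 / 8) * ‖η‖ ^ 2)) := by ring
      _ ≤ _ := mul_le_mul_of_nonneg_left key (by positivity)
  calc ∫ η, ‖g η • ((2 * Real.pi * ‖ξ - η‖ ^ 2)⁻¹ • (ξ - η))‖
      ≤ ∫ η, (2 * Real.pi)⁻¹ * B * ((ball (0 : EuclideanSpace ℝ (Fin 2)) 1).indicator (fun z => ‖z‖⁻¹) (ξ - η) +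
          Real.exp (-(1 / 8) * ‖η‖ ^ 2)) :=
        integral_mono (gain_integrable_smul_gradLogKernel hg hg0 ξ).norm ((h1.add hI).const_mul _) hle
    _ = _ := by
        rw [integral_const_mul, integral_add h1 hI,
          integral_sub_left_eq_self ((ball (0 : EuclideanSpace ℝ (Fin 2)) 1).indicator fun z => ‖z‖⁻¹) volume ξ]

/-- **The logarithmic potential of a bounded measurable Gaussian-class density** (registered helper toward
`stub_cellStreamSolvability`): for `g` measurable with `|g(η)| ≤ B e^{−‖η‖²/8}`, `ψ = N ∗ g` (`N = (2π)⁻¹ log ‖·‖`) is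
`C¹` on `ℝ²`; for every `ξ` the Biot–Savart-type integrand `g(η) DN(ξ − η)`, `DN(z) = (2π‖z‖²)⁻¹ z`, is integrable and
`∇ψ(ξ) = ∫ g(η) DN(ξ − η) dη`; and `|ψ(ξ)| ≤ C (1 + log(1 + ‖ξ‖))`, `‖∇ψ(ξ)‖ ≤ C` for one constant `C`. The derivative is
gained from the kernel: regularisation `N_ε = (4π)⁻¹ log(‖·‖² + ε²)`, uniform convergence of the regularised gradients,
and the uniform-limit-of-derivatives theorem. [folklore] -/
theorem logPotential_gain :
    ∀ (B : ℝ) (g : EuclideanSpace ℝ (Fin 2) → ℝ), Measurable g →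
      (∀ η, |g η| ≤ B * Real.exp (-(1 / 8) * ‖η‖ ^ 2)) →
      ContDiff ℝ 1 (fun ξ : EuclideanSpace ℝ (Fin 2) => ∫ η, (2 * Real.pi)⁻¹ * Real.log ‖ξ - η‖ * g η) ∧
      (∀ ξ : EuclideanSpace ℝ (Fin 2),
        Integrable (fun η : EuclideanSpace ℝ (Fin 2) => g η • ((2 * Real.pi * ‖ξ - η‖ ^ 2)⁻¹ • (ξ - η))) ∧
          gradient (fun ξ : EuclideanSpace ℝ (Fin 2) => ∫ η, (2 * Real.pi)⁻¹ * Real.log ‖ξ - η‖ * g η) ξ =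
            ∫ η, g η • ((2 * Real.pi * ‖ξ - η‖ ^ 2)⁻¹ • (ξ - η))) ∧
      ∃ C : ℝ, ∀ ξ : EuclideanSpace ℝ (Fin 2),
        |∫ η, (2 * Real.pi)⁻¹ * Real.log ‖ξ - η‖ * g η| ≤ C * (1 + Real.log (1 + ‖ξ‖)) ∧
        ‖gradient (fun ξ : EuclideanSpace ℝ (Fin 2) => ∫ η, (2 * Real.pi)⁻¹ * Real.log ‖ξ - η‖ * g η) ξ‖ ≤ C := by
  intro B g hg hg0
  obtain ⟨hint, hD, hcont⟩ := logPotential_gain_hasFDerivAt B g hg hg0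
  have hintv := fun ξ => gain_integrable_smul_gradLogKernel hg hg0 ξ
  have hfd : fderiv ℝ (fun ξ : EuclideanSpace ℝ (Fin 2) => ∫ η, (2 * Real.pi)⁻¹ * Real.log ‖ξ - η‖ * g η) =
      fun ξ => ∫ η, (g η * ((2 * Real.pi)⁻¹ * (‖ξ - η‖ ^ 2)⁻¹)) • innerSL ℝ (ξ - η) :=
    funext fun ξ => (hD ξ).fderiv
  have hgrad : ∀ ξ : EuclideanSpace ℝ (Fin 2),
      gradient (fun ξ : EuclideanSpace ℝ (Fin 2) => ∫ η, (2 * Real.pi)⁻¹ * Real.log ‖ξ - η‖ * g η) ξ =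
        ∫ η, g η • ((2 * Real.pi * ‖ξ - η‖ ^ 2)⁻¹ • (ξ - η)) := by
    intro ξ
    refine ext_inner_left ℝ fun v => ?_
    rw [← integral_inner (hintv ξ) v, real_inner_comm, gradient, InnerProductSpace.toDual_symm_apply,
      (hD ξ).fderiv, ContinuousLinearMap.integral_apply (hint ξ) v]
    refine integral_congr_ae (Eventually.of_forall fun η => ?_)
    simp only [_root_.smul_apply, innerSL_apply_apply, smul_eq_mul, real_inner_smul_right, mul_inv]
    rw [real_inner_comm (ξ - η) v]
    ring
  refine ⟨?_, fun ξ => ⟨hintv ξ, hgrad ξ⟩, ?_⟩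
  · rw [contDiff_one_iff_fderiv, hfd]
    exact ⟨fun ξ => (hD ξ).differentiableAt, hcont⟩
  · obtain ⟨C₁, -, hC₁⟩ := abs_logPotential_le hg0
    obtain ⟨M, hM⟩ := gain_exists_integral_norm_le hg hg0
    refine ⟨max C₁ M, fun ξ => ⟨?_, ?_⟩⟩
    · have hl : 0 ≤ 1 + Real.log (1 + ‖ξ‖) := by
        have := Real.log_nonneg (by linarith [norm_nonneg ξ] : (1:ℝ) ≤ 1 + ‖ξ‖)
        linarith
      exact (hC₁ ξ).trans (mul_le_mul_of_nonneg_right (le_max_left _ _) hl)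
    · rw [hgrad ξ]
      exact (norm_integral_le_integral_norm _).trans ((hM ξ).trans (le_max_right _ _))

end Summit.AnomalousDissipation.AnomalousDissipation.Theorems.MarginalStabilityChainStretchedVortexRows

end
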